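import Summits.ResolutionOfSingularities.ResolutionOfSingularities.Theorems.EquisingularLiftEquisingularLiftNatMemberStepRegularPack
import Summits.ResolutionOfSingularities.ResolutionOfSingularities.Theorems.EquisingularLiftEquisingularLiftNatSubchainSupplierInvDefs
import Summits.ResolutionOfSingularities.ResolutionOfSingularities.Theorems.EquisingularLiftEquisingularLiftNatInCarrierSection
import Summits.ResolutionOfSingularities.ResolutionOfSingularities.Theorems.EquisingularLiftEquisingularLiftNatModelPointStepOfSection
import Summits.ResolutionOfSingularities.ResolutionOfSingularities.Theorems.EquisingularLiftEquisingularLiftNatInCarrierStepExact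
import Summits.ResolutionOfSingularities.ResolutionOfSingularities.Theorems.EquisingularLiftEquisingularLiftNatRegularPointStepExact
import Summits.ResolutionOfSingularities.ResolutionOfSingularities.Theorems.EquisingularLiftEquisingularLiftNatInCarrierStepFlat
import Summits.ResolutionOfSingularities.ResolutionOfSingularities.Theorems.EquisingularLiftEquisingularLiftNatCarrierPairStrictTransformRegular
import Summits.ResolutionOfSingularities.ResolutionOfSingularities.Theorems.EquisingularLiftEquisingularLiftChainRegular
import Summits.ResolutionOfSingularities.ResolutionOfSingularities.Theorems.EquisingularLiftEquisingularLiftNatExactShadowPlanar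
import Literature.AlgebraicGeometry.Resolution.BlowupsExistence
import HarnessLib

/-!
# [OURS · L1 W4.5(b) · EL♮(3)] HSUB(ReachTC⁺)₃ assembly (A), part 2 — `member_strictTransform_of_regularPoint`: the MEMBER-LEVEL REGULAR STEP of
# the invariant `TCPlus.Inv` (registered stub `stub_elnat_tcPlusPointResolution`; driver `hsub_reachTCPlus_of_invariant` p526242, clause
# (step, flag kept); brick (A) of res-L1-w45b-stub-1's recipe `L/res-L1-w45b-stub-1/NOTES.md` l.12)

Crux `EquisingularLiftNat` = stmt-ResolutionOfSingularities-20038 (child EL♮(3) = stmt-ResolutionOfSingularities-20148), route EquisingularLift, line `sections`.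
Helper file `--supports stmt-ResolutionOfSingularities-20148 --as helper` by res-L1-w45b-stub-4 (res-L1-w45b-plan-1 RULING 2026-08-27T14:38:30Z (R-B)).
HONEST FRAMING: OURS (cell res-hironaka, slot W4.5(b)); NOT a statement of any manuscript; AI-written, weaker than expert review. No `sorry`; standard axioms.

THE STEP. A `TCPlus.Member O k θ P q Y Ch G T Z excl` (…NatSubchainSupplierInvDefs v3, p532383: an upstairs `Ch`-stage `(X, σ, S)` with model square
`jG : G → X` over `Spec θ`, `jG '' T = S`, and an in-carrier pair `(𝓢, K)` with clauses (i)–(vi)); a CLOSED point `y ∈ closure Z ∩ T` of the running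
curve, NOT excluded (`y ∉ excl`), at which the reduced curve `V(𝓘⟨closure Z⟩)` and `G` are regular; `T ⊄ closure Z`; the point blow-up
`υ₁ : G₂ → G` of `𝓘{y}`. OUTPUT: `G₂` integral, `closure υ₁⁻¹(T ∖ {y})` irreducible and not inside `closure υ₁⁻¹(Z ∖ {y})`, and a
`TCPlus.Member O k θ P q Y Ch G₂ (closure υ₁⁻¹(T ∖ {y})) (closure υ₁⁻¹(Z ∖ {y})) (υ₁⁻¹ excl)` — the clause (step, flag kept) of the driver at the
member level. Clause (vi) (centred packages at the excluded points, all ≠ y) is transported along the step by a HYPOTHESIS `hpkg` in the shape of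
res-D-pv-029's T-PKG-TRANSPORT-SCHEME `centredPackage_strictTransform` (NAMED 2026-08-27T14:19:08Z, not yet landed); with `excl = ∅` it is not used.

ASSEMBLY (no new mathematics): the in-carrier SECTION `s` through `jG y` on `D = V(𝓢 ⊔ K)` (stub-1 `exists_inCarrier_section` p528314; the regular
special fibre at `y` is clause (i)); the upstairs blow-up `τ : X₂ → X` of `ker s` (`exists_isBlowup`) and res-D-pv-029's `modelPointStep_of_section`
(p526229: new `Ch`-stage, regular / integral / dominant, `G₂` integral, strict transform irreducible, `(ker s)·𝒪_G = 𝔪_y`, the new model square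
`j₂ : G₂ → X₂` with `j₂ ≫ τ = υ₁ ≫ jG` and matching strict transforms); the new pair `(St 𝓢, St K)`: (i) stub-1 `comap_strictTransformIdeal_carrierPair_eq_sup`
(p533779) ∘ res-D-pv-029 `strictTransformIdeal_sup_eq_vanishingIdeal_of_regularPoint` (p532793, with stub-4's K7a p531318); (ii) stub-2
`flat_carrierStrictTransform_subschemeι_comp_stage` (p532002) on the adapted order-one cone pack (part 1 `exists_adaptedConePack`); (iii) stub-2
`member_clause_iii_strictTransform_section` (p529806); (iv) `supp St ⊆ τ⁻¹ supp`; (v) part 1 `member_clause_v_carrierStrictTransform`; (vi) `hpkg`.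

References: the cited tree files; [cite: GortzWedhorn2020, Prop. 13.91]; [cite: Liu2002, Thm. 8.1.19].
-/

set_option linter.dupNamespace false -- mandated namespace `Summit.<Summit>.<Problem>` of this single-conjunct summit
set_option linter.overlappingInstances false -- signatures carry `[IsDomain O] [IsDiscreteValuationRing O]`

noncomputable section

open CategoryTheory CategoryTheory.Limits AlgebraicGeometry TopologicalSpace Topology IsLocalRing
open Literature.AlgebraicGeometry.Resolution
open AlgebraicGeometry.Scheme.IdealSheafData
open Summit.ResolutionOfSingularities.ResolutionOfSingularities.Theses.EquisingularLift.Split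
open Summit.ResolutionOfSingularities.ResolutionOfSingularities.Cruxes.EquisingularLift.StrataSplit

namespace Summit.ResolutionOfSingularities.ResolutionOfSingularities.Cruxes.EquisingularLiftNat.Sections

/-- Regularity of the local ring of a closed-subscheme point is insensitive to rewriting the ideal sheaf along an equality. [folklore] -/
theorem isRegularLocalRing_stalk_subscheme_of_eq {G : Scheme.{0}} {I J : G.IdealSheafData} (e : I = J) (y' : ↥I.subscheme)
    (y : ↥J.subscheme) (h : I.subschemeι y' = J.subschemeι y) (hreg : IsRegularLocalRing (J.subscheme.presheaf.stalk y)) :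
    IsRegularLocalRing (I.subscheme.presheaf.stalk y') := by
  subst e
  have : y' = y := I.subschemeι.isClosedEmbedding.injective h
  subst this
  exact hreg

/-- The image of a principal ideal under a ring map is principal. [folklore] -/
theorem isPrincipal_map_of_isPrincipal {R S : Type*} [CommRing R] [CommRing S] (f : R →+* S) {I : Ideal R}
    (hI : I.IsPrincipal) : (I.map f).IsPrincipal := by
  obtain ⟨a, ha⟩ := hI.principal
  refine ⟨⟨f a, ?_⟩⟩
  change I = Ideal.span {a} at ha
  rw [ha, Ideal.map_span, Set.image_singleton]

/-- **(A) THE MEMBER-LEVEL REGULAR STEP `member_strictTransform_of_regularPoint`.** See the module docstring: from a `TCPlus.Member … G T Z excl`, a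
closed regular point `y ∈ closure Z ∩ T`, `y ∉ excl`, `T ⊄ closure Z`, of the running curve (the reduced curve and `G` regular at `y`), and the point
blow-up `υ₁ : G₂ → G` of `𝓘{y}` — the next `TCPlus.Member … G₂ (closure υ₁⁻¹(T ∖ {y})) (closure υ₁⁻¹(Z ∖ {y})) (υ₁⁻¹ excl)`, with `G₂` integral and
the new running curve irreducible and not inside the new `closure Z₂`. The hypothesis `hpkg` is the package transport of res-D-pv-029's
T-PKG-TRANSPORT-SCHEME (used only at the points of `excl`). [cite: GortzWedhorn2020, Prop. 13.91; Liu2002, Thm. 8.1.19] [OURS · L1 W4.5b] toward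
`stub_elnat_tcPlusPointResolution` (stmt-ResolutionOfSingularities-20038 / -20148); NOT a statement of the manuscript. -/
theorem member_strictTransform_of_regularPoint (O : Type) [CommRing O] [IsDomain O] [IsDiscreteValuationRing O]
    [IsAdicComplete (maximalIdeal O) O] [IsAlgClosed (ResidueField O)] (k : Type) [Field k] (θ : O →+* k)
    (hθ : Function.Surjective θ)
    (P : Scheme.{0}) (q : P ⟶ Spec (.of O)) (Y : Set P) (hY : Y ⊆ q ⁻¹' {closedPoint O}) (hYirr : IsIrreducible Y)
    (hYcl : IsClosed Y) [IsProper q] [IsIntegral P] (hPnoeth : IsLocallyNoetherian P) (hPreg : Scheme.IsRegular P)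
    [SmoothOfRelativeDimension 3 q]
    (Ch : ∀ X' : Scheme.{0}, (X' ⟶ P) → Set X' → Prop)
    (hChain : ∀ (X' : Scheme.{0}) (σ : X' ⟶ P) (S : Set X'), Ch X' σ S → Chain P Y X' σ S)
    (hStep : ∀ (X' X'' : Scheme.{0}) (σ' : X' ⟶ P) (S' : Set X') (C : X'.IdealSheafData) (τ : X'' ⟶ X'),
      Ch X' σ' S' → IsBlowup τ C → Scheme.IsRegular C.subscheme → Flat (C.subschemeι ≫ σ' ≫ q) →
      σ' '' (C.support : Set X') ⊆ {x : P | ¬ IsGenericPoint x Y} →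
      (C.support : Set X') ∩ (σ' ≫ q) ⁻¹' {closedPoint O} ⊆ S' →
      Ch X'' (τ ≫ σ') (closure (τ ⁻¹' (S' \ (C.support : Set X')))))
    -- the package transport (res-D-pv-029's T-PKG-TRANSPORT-SCHEME), used only at the excluded points
    (hpkg : ∀ ⦃X X₂ : Scheme.{0}⦄ [IsIntegral X] [IsLocallyNoetherian X] [IsLocallyNoetherian X₂] (σ : X ⟶ P)
      [IsSeparated (σ ≫ q)], Scheme.IsRegular X → ∀ (s : Spec (.of O) ⟶ X), s ≫ σ ≫ q = 𝟙 _ → ∀ (τ : X₂ ⟶ X), IsBlowup τ s.ker →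
      ∀ (𝓢 K : X.IdealSheafData) (p' : X), p' ∉ (s.ker.support : Set X) → ∀ (p'₂ : X₂), τ p'₂ = p' →
      TCPlus.CentredPackage O P q X σ 𝓢 K p' →
      TCPlus.CentredPackage O P q X₂ (τ ≫ σ) (strictTransformIdeal τ s.ker 𝓢) (strictTransformIdeal τ s.ker K) p'₂)
    -- the member and the point
    (G : Scheme.{0}) [IsIntegral G] (T Z excl : Set G) (hmem : TCPlus.Member O k θ P q Y Ch G T Z excl)
    (hTirr : IsIrreducible T) (y : G) (hy : IsClosed ({y} : Set G)) (hyZ : y ∈ closure Z) (hyT : y ∈ T) (hTZ : ¬ T ⊆ closure Z)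
    (hyexcl : y ∉ excl)
    (hyreg : IsRegularLocalRing (G.presheaf.stalk y ⧸ stalkIdeal (vanishingIdeal ⟨closure Z, isClosed_closure⟩) y))
    (hamb : IsRegularLocalRing (G.presheaf.stalk y))
    (G₂ : Scheme.{0}) (υ₁ : G₂ ⟶ G) (hυ₁ : IsBlowup υ₁ (vanishingIdeal ⟨{y}, hy⟩)) :
    IsIntegral G₂ ∧ IsIrreducible (closure (υ₁ ⁻¹' (T \ {y}))) ∧
      ¬ closure (υ₁ ⁻¹' (T \ {y})) ⊆ closure (closure (υ₁ ⁻¹' (Z \ {y}))) ∧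
      TCPlus.Member O k θ P q Y Ch G₂ (closure (υ₁ ⁻¹' (T \ {y}))) (closure (υ₁ ⁻¹' (Z \ {y}))) (υ₁ ⁻¹' excl) := by
  classical
  obtain ⟨X, σ, S, jG, tG, 𝓢, K, hCh, hXint, hXnoeth, hXreg, hdom, hsq, hTS, hi, hii, hiii, hiiip, hiv, hv, hvi⟩ := hmem
  haveI := hXint
  haveI := hXnoeth
  obtain ⟨ϖ, hϖ⟩ := IsDiscreteValuationRing.exists_irreducible O
  -- properness / separatedness / finite type of the stage over `O`
  obtain ⟨-, -, hσ⟩ := chain_isRegular P Y X σ S (hChain _ _ _ hCh) hPnoeth hPreg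
  haveI := hσ
  haveI : IsProper (σ ≫ q) := inferInstance
  -- the model square: `jG` is a closed immersion onto the special fibre
  haveI : IsClosedImmersion (Spec.map (CommRingCat.ofHom θ)) := IsClosedImmersion.spec_of_surjective _ hθ
  haveI hjci : IsClosedImmersion jG := MorphismProperty.IsStableUnderBaseChange.of_isPullback hsq.flip inferInstance
  have hrangej : Set.range jG = (σ ≫ q) ⁻¹' {closedPoint O} := by
    rw [range_eq_preimage_of_isPullback hsq, range_specMap_of_surjective_of_field θ hθ]
  have hjsp : ∀ y' : G, (σ ≫ q) (jG y') = closedPoint O := fun y' => by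
    have h1 : jG y' ∈ Set.range jG := ⟨y', rfl⟩
    rw [hrangej] at h1
    exact h1
  have hjcl : ∀ y' : G, IsClosed ({y'} : Set G) → IsClosed ({jG y'} : Set X) := fun y' hy' => by
    have h1 := hjci.isClosedEmbedding.isClosedMap _ hy'
    rwa [Set.image_singleton] at h1
  -- the point `p = jG y` lies on `D = V(𝓢 ⊔ K)`; the generic point of `Y`
  have hZsupp : ((vanishingIdeal (⟨closure Z, isClosed_closure⟩ : Closeds G)).support : Set G) = closure Z :=
    Scheme.IdealSheafData.coe_support_vanishingIdeal _
  have hyC : jG y ∈ ((𝓢 ⊔ K).support : Set X) := by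
    have h1 : y ∈ (((𝓢 ⊔ K).comap jG).support : Set G) := by rw [hi, hZsupp]; exact hyZ
    rw [Scheme.IdealSheafData.support_comap] at h1
    exact h1
  obtain ⟨hDreg, hDcod⟩ := hv (jG y) hyC (hjsp y) (by
    rintro ⟨y₀, hy₀, he⟩
    exact hyexcl (hjci.isClosedEmbedding.injective he ▸ hy₀))
  have hpcl : IsClosed ({jG y} : Set X) := hjcl y hy
  have hDdim := hDcod hpcl
  have hreg : IsRegularLocalRing (X.presheaf.stalk (jG y)) := hXreg (jG y)
  have hξ : IsGenericPoint hYirr.genericPoint Y := hYirr.isGenericPoint_genericPoint hYcl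
  have hdim : ringKrullDim (X.presheaf.stalk (jG y)) = (3 + 1 : ℕ) :=
    ringKrullDim_stalk_eq_succ_of_chain q 3 hξ (hChain _ _ _ hCh) hpcl (by
      simpa only [Scheme.Hom.comp_base, TopCat.coe_comp, Function.comp_apply] using hjsp y)
  obtain ⟨h𝓢p, hKp⟩ := hiiip (jG y)
  -- (1) the in-carrier section through `jG y`
  have hfib : ∀ y' : ↥((𝓢 ⊔ K).comap jG).subscheme, ((𝓢 ⊔ K).comap jG).subschemeι y' = y →
      IsRegularLocalRing (((𝓢 ⊔ K).comap jG).subscheme.presheaf.stalk y') := by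
    intro y' hy'
    -- `y` as a point of `V(𝓘⟨closure Z⟩)`
    have hyr : y ∈ Set.range (vanishingIdeal (⟨closure Z, isClosed_closure⟩ : Closeds G)).subschemeι := by
      rw [Scheme.IdealSheafData.range_subschemeι, hZsupp]; exact hyZ
    obtain ⟨y₁, hy₁⟩ := hyr
    refine isRegularLocalRing_stalk_subscheme_of_eq hi y' y₁ (hy'.trans hy₁.symm) ?_
    exact (isRegularLocalRing_stalk_subscheme_iff _ y₁).mpr (by rw [hy₁]; exact hyreg)
  obtain ⟨s, hs, hss₀, hle, -, -⟩ := exists_inCarrier_section O k θ hθ X G (σ ≫ q) jG tG hsq (𝓢 ⊔ K) hii y hy hyC hDreg hfib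
  -- (2) the upstairs blow-up and the model point step
  obtain ⟨X₂, τ, hτ⟩ := exists_isBlowup X s.ker
  have hyZ' : y ∈ closure Z := hyZ
  have hTx : ¬ T ⊆ {y} := fun h => hTZ (h.trans (Set.singleton_subset_iff.mpr hyZ'))
  have hw : ¬ IsGenericPoint (σ (jG y)) Y := hiv ⟨jG y, hyC, rfl⟩
  obtain ⟨hCh₂, hX₂reg, hX₂noeth, hX₂int, hdom₂, hG₂int, hirr₂, hJ, -, -, -, j₂, t₂, hsq₂, hcomm, -, hS₂⟩ :=
    modelPointStep_of_section O k θ hθ P q Y hY hYirr hYcl Ch hChain hStep X σ S hCh hXreg hdom G jG tG hsq T hTS y hy hyT hTx hw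
      s hs hss₀ X₂ τ hτ G₂ υ₁ hυ₁
  haveI := hX₂noeth
  haveI := hX₂int
  haveI := hG₂int
  haveI : IsProper τ := hτ.isProper
  -- the centre: `supp ker s = s(Spec O) = {jG y, s η}`
  obtain ⟨_, -, -, hCsupp⟩ := section_isClosedImmersion_and_isRegular_ker O X (σ ≫ q) s hs
  have hrs : ∀ u : Spec (.of O), (σ ≫ q) (s u) = u := fun u => by rw [← Scheme.Hom.comp_apply, hs]; rfl
  have hexcl_off : ∀ y₀ ∈ excl, jG y₀ ∉ (s.ker.support : Set X) := by
    intro y₀ hy₀ hmem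
    rw [hCsupp] at hmem
    obtain ⟨u, hu⟩ := hmem
    have hu' : u = closedPoint O := by rw [← hrs u, hu]; exact hjsp y₀
    rw [hu', hss₀] at hu
    exact hyexcl (hjci.isClosedEmbedding.injective hu ▸ hy₀)
  haveI : IsLocallyNoetherian G := LocallyOfFiniteType.isLocallyNoetherian jG
  haveI : IsProper υ₁ := hυ₁.isProper
  haveI : IsLocallyNoetherian G₂ := LocallyOfFiniteType.isLocallyNoetherian υ₁
  -- (3) the adapted order-one cone pack at `s(s₀) = jG y`
  have hreg' : IsRegularLocalRing (X.presheaf.stalk (s (closedPoint O))) := by rw [hss₀]; exact hreg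
  have hdim' : ringKrullDim (X.presheaf.stalk (s (closedPoint O))) = (3 + 1 : ℕ) := by rw [hss₀]; exact hdim
  have h𝓢p' : (stalkIdeal 𝓢 (s (closedPoint O))).IsPrincipal := by rw [hss₀]; exact h𝓢p
  have hKp' : (stalkIdeal K (s (closedPoint O))).IsPrincipal := by rw [hss₀]; exact hKp
  have hDreg' : IsRegularLocalRing (X.presheaf.stalk (s (closedPoint O)) ⧸ stalkIdeal (𝓢 ⊔ K) (s (closedPoint O))) := by
    rw [hss₀]; exact hDreg
  have hDdim' : ringKrullDim (X.presheaf.stalk (s (closedPoint O)) ⧸ stalkIdeal (𝓢 ⊔ K) (s (closedPoint O))) + 2 =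
      ringKrullDim (X.presheaf.stalk (s (closedPoint O))) := by rw [hss₀]; exact hDdim
  obtain ⟨c, Φ, g, hcJ, hcq, hcdom, hcb, h𝔪c, h𝓢c, hΦ1, hKc, hΦc, hΦ𝔪, hgC, hg0, hCg, h𝓢0⟩ :=
    exists_adaptedConePack O σ q s hs rfl hreg' hdim' ϖ hϖ 𝓢 K hle h𝓢p' hKp' hDreg' hDdim'
  haveI := hcdom
  -- (i) exact special fibre
  have hi₂ : (strictTransformIdeal τ s.ker 𝓢 ⊔ strictTransformIdeal τ s.ker K).comap j₂ =
      vanishingIdeal ⟨closure (closure (υ₁ ⁻¹' (Z \ {y}))), isClosed_closure⟩ := by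
    have e₁ := comap_strictTransformIdeal_carrierPair_eq_sup O k θ hθ (σ ≫ q) jG tG hsq s hs τ hτ υ₁ j₂ hcomm y hy hυ₁ hJ hss₀ hreg ϖ hϖ
      𝓢 K hle h𝓢p hKp hDreg hDdim
    have h𝓢y : (stalkIdeal (𝓢.comap jG) y).IsPrincipal := by
      rw [stalkIdeal_comap_eq_map_stalkMap]; exact isPrincipal_map_of_isPrincipal _ h𝓢p
    have hKy : (stalkIdeal (K.comap jG) y).IsPrincipal := by
      rw [stalkIdeal_comap_eq_map_stalkMap]; exact isPrincipal_map_of_isPrincipal _ hKp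
    have hD : 𝓢.comap jG ⊔ K.comap jG = vanishingIdeal ⟨closure Z, isClosed_closure⟩ := by
      rw [← Scheme.IdealSheafData.comap_sup]; exact hi
    have e₂ := strictTransformIdeal_sup_eq_vanishingIdeal_of_regularPoint υ₁ hy hυ₁ hamb (𝓢.comap jG) (K.comap jG) h𝓢y hKy Z hD hyreg
    rw [e₁, e₂]
    congr 1
    exact Closeds.ext closure_closure.symm
  -- (ii) flat over `O`
  have hii₂ : Flat ((strictTransformIdeal τ s.ker 𝓢 ⊔ strictTransformIdeal τ s.ker K).subschemeι ≫ (τ ≫ σ) ≫ q) :=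
    flat_carrierStrictTransform_subschemeι_comp_stage O σ q s hs τ hτ 𝓢 K hii c hcJ h𝓢c Φ hΦ1 hKc ϖ hϖ h𝔪c hdim' hΦ𝔪
  -- (iii) regular carrier, principal stalks
  obtain ⟨⟨hiii₂, hiiip₂⟩, -⟩ := member_clause_iii_strictTransform_section O (σ ≫ q) s hs hXreg hτ 𝓢 K hle h𝓢0 ⟨hiii, hiiip⟩
  -- (iv) off the generic point of `Y`
  have hsupp₂ : ((strictTransformIdeal τ s.ker 𝓢 ⊔ strictTransformIdeal τ s.ker K).support : Set X₂) ⊆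
      τ ⁻¹' ((𝓢 ⊔ K).support : Set X) := by
    intro z hz
    have h1 : z ∈ (((𝓢 ⊔ K).comap τ).support : Set X₂) := by
      refine Scheme.IdealSheafData.support_antitone ?_ hz
      rw [Scheme.IdealSheafData.comap_sup]
      exact sup_le_sup (comap_le_strictTransformIdeal τ s.ker 𝓢) (comap_le_strictTransformIdeal τ s.ker K)
    rw [Scheme.IdealSheafData.support_comap] at h1
    exact h1
  have hiv₂ : (τ ≫ σ) '' ((strictTransformIdeal τ s.ker 𝓢 ⊔ strictTransformIdeal τ s.ker K).support : Set X₂) ⊆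
      {x : P | ¬ IsGenericPoint x Y} := by
    rintro _ ⟨z, hz, rfl⟩
    rw [Scheme.Hom.comp_apply]
    exact hiv ⟨τ z, hsupp₂ hz, rfl⟩
  -- (v) regular quotient stalks off the excluded points
  have hEX : ∀ z : X₂, τ z ∉ (s.ker.support : Set X) → τ z ∈ jG '' excl → z ∈ j₂ '' (υ₁ ⁻¹' excl) := by
    rintro z hzc ⟨y₀, hy₀, hy₀z⟩
    have hy₀ne : y₀ ∉ (((vanishingIdeal ⟨{y}, hy⟩ : G.IdealSheafData)).support : Set G) := by
      rw [Scheme.IdealSheafData.coe_support_vanishingIdeal]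
      rintro (rfl : y₀ = y)
      apply hzc
      rw [← hy₀z, ← hss₀, hCsupp]
      exact ⟨_, rfl⟩
    obtain ⟨y₀₂, hy₀₂⟩ := exists_preimage_of_not_mem_support υ₁ (vanishingIdeal ⟨{y}, hy⟩) hυ₁ hy₀ne
    have h1 : τ (j₂ y₀₂) = τ z := by rw [← Scheme.Hom.comp_apply, hcomm, Scheme.Hom.comp_apply, hy₀₂, hy₀z]
    obtain ⟨z', -, huniq⟩ := existsUnique_preimage τ hτ.isIso_compl (W := centreCompl s.ker) (y := τ z) hzc
    refine ⟨y₀₂, show υ₁ y₀₂ ∈ excl by rw [hy₀₂]; exact hy₀, ?_⟩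
    rw [huniq (j₂ y₀₂) h1, ← huniq z rfl]
  have hv₂ := member_clause_v_carrierStrictTransform O σ q s hs hτ 𝓢 K c hcJ hcq hcb h𝓢c Φ hΦ1 hΦc hKc hDreg' hDdim' g hgC hg0 hCg
    (jG '' excl) (j₂ '' (υ₁ ⁻¹' excl)) hEX hv
  -- (vi) the centred packages at the excluded points, transported
  have hvi₂ : ∀ y₀₂ ∈ υ₁ ⁻¹' excl, TCPlus.CentredPackage O P q X₂ (τ ≫ σ) (strictTransformIdeal τ s.ker 𝓢)
      (strictTransformIdeal τ s.ker K) (j₂ y₀₂) := by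
    intro y₀₂ hy₀₂
    have hy₀ : υ₁ y₀₂ ∈ excl := hy₀₂
    exact hpkg σ hXreg s hs τ hτ 𝓢 K (jG (υ₁ y₀₂)) (hexcl_off _ hy₀) (j₂ y₀₂)
      (by rw [← Scheme.Hom.comp_apply, hcomm, Scheme.Hom.comp_apply]) (hvi _ hy₀)
  -- the new running curve is not inside the new `closure Z₂`
  have hT₂Z₂ : ¬ closure (υ₁ ⁻¹' (T \ {y})) ⊆ closure (closure (υ₁ ⁻¹' (Z \ {y}))) := by
    rw [closure_closure]
    intro hsub
    have h1 : T \ {y} ⊆ closure Z := by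
      intro t ht
      have htne : t ∉ (((vanishingIdeal ⟨{y}, hy⟩ : G.IdealSheafData)).support : Set G) := by
        rw [Scheme.IdealSheafData.coe_support_vanishingIdeal]; exact ht.2
      obtain ⟨t₂, ht₂⟩ := exists_preimage_of_not_mem_support υ₁ (vanishingIdeal ⟨{y}, hy⟩) hυ₁ htne
      have h2 : t₂ ∈ closure (υ₁ ⁻¹' (Z \ {y})) := hsub (subset_closure (by rw [Set.mem_preimage, ht₂]; exact ht))
      have h3 : closure (υ₁ ⁻¹' (Z \ {y})) ⊆ υ₁ ⁻¹' closure Z :=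
        closure_minimal (fun u hu => subset_closure hu.1) (isClosed_closure.preimage υ₁.continuous)
      have h4 := h3 h2
      rw [Set.mem_preimage, ht₂] at h4
      exact h4
    have h2 : T ⊆ closure Z ∪ {y} := fun t ht => by
      by_cases hty : t = y
      · exact Or.inr hty
      · exact Or.inl (h1 ⟨ht, hty⟩)
    rcases (isPreirreducible_iff_isClosed_union_isClosed.mp hTirr.isPreirreducible) _ _ isClosed_closure hy h2 with h | h
    · exact hTZ h
    · exact hTx h
  exact ⟨hG₂int, hirr₂, hT₂Z₂, X₂, τ ≫ σ, _, j₂, t₂, strictTransformIdeal τ s.ker 𝓢, strictTransformIdeal τ s.ker K, hCh₂, hX₂int,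
    hX₂noeth, hX₂reg, hdom₂, hsq₂, hS₂, hi₂, hii₂, hiii₂, hiiip₂, hiv₂, hv₂, hvi₂⟩

end Summit.ResolutionOfSingularities.ResolutionOfSingularities.Cruxes.EquisingularLiftNat.Sections

end
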